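import Summits.CriticalPhenomena.SAWScalingLimit.Theorems.SAWDevelopingMapHexConjectureRangeIdentificationFloor
import Summits.CriticalPhenomena.SAWScalingLimit.Theorems.SAWDevelopingMapHexConjectureAvoidanceCocycleArch
import Summits.CriticalPhenomena.SAWScalingLimit.Theorems.SAWDevelopingMapHexConjectureCurveUpgradeMain
import HarnessLib

/-!
# Crux `HexConjecture` (stmt-CriticalPhenomena-0808), line `root-locality-replaces-loewner`:
the FLOOR-CLASS reach of the line, assembled over landed files

Landing target:
`Summits/CriticalPhenomena/SAWScalingLimit/Theorems/SAWDevelopingMapHexConjectureFloorAssembly.lean`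
(`--supports stmt-CriticalPhenomena-0808`; lead continuation prover-line-stmt-CriticalPhenomena-0808-c1-0).

* `convergesInLawToSLE_at_of_cocycle_at` — POINTWISE closing of the restriction line for a fixed marked domain
  `(D; a, b)` and fixed endpoint approximations: avoidance cocycle with the SLE(8/3) value for every hull subdomain
  ⟹ (range identification, `hexRangeLimit_at_of_cocycle_at`, p115940) range convergence ⟹ (abstract curve upgrade
  `Upgrade.curveUpgrade`, p108020, fed with the deterministic endpoints of the lattice polylines and ONE regularity
  input: no triple strands in law) convergence in law to chordal SLE(8/3) in `CurveClass ℂ`.  Tightness is an OUTPUT.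
* `hexConjectureFloor_of_cocycle_nonRetracing` — the floor-class form: `HexAvoidanceCocycleFloor → HexNonRetracingFloor →
  HexConjectureFloor` (the skeleton's statements 3♭/4♭/5♭/6 ⟹ 7♭'s hypothesis).
* `hexConjectureFloor_of_archTightness` — with the lever in positive form (`hexAvoidanceCocycleFloor_of_archTightness`,
  p116148): **DCS Conjecture 2 (`HexObservableLimitR` = `HexObservableLimit`, stmt-14003) + half-plane arch tightness
  (crux-10472's registered open stub) + non-retracing ⟹ the crux on the floor class.**  Compare crux-10472's landed
  `FloorRatio.stub_floorObservableToSLE_of_estimates : HPAT → UIM → HexObservableLimit → HexTight → (same conclusion,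
  floor-vertex endpoints)`: the restriction closing through range identification needs NO tightness input
  (`HexTight`, crux stmt-5423), and its regularity input (non-retracing) is implied by 10472's uniform injectivity
  modulus (sibling file `…NonRetracingOfModulus`).
-/

noncomputable section

open scoped Topology NNReal ENNReal
open Filter Set Metric MeasureTheory
open Literature.Probability.LatticeModels (HexVertex hexGraph hexCenter)
open Literature.Probability.RandomPlanarGeometry
open Literature.Probability.RandomPlanarGeometry.SAW

namespace Summit.CriticalPhenomena.SAWScalingLimit.Theorems.HexConjecture.RootLocality

/-- **Pointwise closing of the restriction line.**  Fix a Dobrushin domain `(D; a, b)` and endpoint approximations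
`a δ → a`, `b δ → b` (`IsEmbEndpointApprox`).  If the probabilities of the closed hull events `{range γ_δ ⊆ cl D'}`
of the critical hexagonal SAW converge to their chordal SLE(8/3) values for every hull subdomain `D'` and every
SLE(8/3) law, and triple strands die in law (`ε → 0` after `δ → 0`), then the SAW curves converge in law to chordal
SLE(8/3) in `CurveClass ℂ`.  Range identification (`hexRangeLimit_at_of_cocycle_at`) + the abstract curve upgrade
(`Upgrade.curveUpgrade`) with the deterministic polyline endpoints `δ·a δ`, `δ·b δ`.
[cite: LawlerSchrammWerner2003Restriction, Thm. 6.1 (p. 23) and Lemma 3.2 (p. 10), transposed to the lattice] -/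
theorem convergesInLawToSLE_at_of_cocycle_at {D : DobrushinDomain} {a b : ℝ → HexVertex}
    (hab : IsEmbEndpointApprox hexGraph hexCenter D a b)
    (hC : ∀ (D' : DobrushinDomain) (μ : Measure (CurveClass ℂ)), D.IsHullSubdomain D' →
      IsSLELaw ((8 : ℝ≥0) / 3) D μ →
      Tendsto (fun δ : ℝ => ((hexSAWLaw D.carrier δ (a δ) (b δ)).map
        (fun γ : HexDomainSAW D.carrier δ (a δ) (b δ) => γ.curve))
        (CurveClass.rangeSubset (closure D'.carrier)))
        (𝓝[>] 0) (𝓝 (μ (CurveClass.rangeSubset (closure D'.carrier)))))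
    (hNR : ∀ ℓ : ℝ, 0 < ℓ → ∀ η : ℝ, 0 < η → ∃ ε : ℝ, 0 < ε ∧ ∀ᶠ δ : ℝ in 𝓝[>] 0,
      hexSAWLaw D.carrier δ (a δ) (b δ)
          {γ | ∃ c : Curve ℂ, CurveClass.mk c = γ.curve ∧ ∃ s t : Fin 3 → unitInterval,
            (∀ i, s i ≤ t i) ∧ t 0 < s 1 ∧ t 1 < s 2 ∧
            (∀ i, ℓ ≤ Metric.diam ((⇑c) '' Set.Icc (s i) (t i))) ∧
            ∀ i j, Metric.hausdorffDist ((⇑c) '' Set.Icc (s i) (t i))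
              ((⇑c) '' Set.Icc (s j) (t j)) ≤ ε} ≤ ENNReal.ofReal η) :
    ConvergesInLawToSLE ((8 : ℝ≥0) / 3) D
      (fun δ (γ : HexDomainSAW D.carrier δ (a δ) (b δ)) => γ.curve)
      (fun δ => hexSAWLaw D.carrier δ (a δ) (b δ)) := by
  obtain ⟨Γ, hΓ, hrange⟩ := hexRangeLimit_at_of_cocycle_at hab hC
  exact Upgrade.curveUpgrade D (fun δ => HexDomainSAW D.carrier δ (a δ) (b δ)) (fun δ γ => γ.curve)
    (fun δ => hexSAWLaw D.carrier δ (a δ) (b δ)) Γ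
    (fun δ => (δ : ℂ) * hexCenter (a δ)) (fun δ => (δ : ℂ) * hexCenter (b δ)) hΓ
    (Eventually.of_forall fun δ => (EmbDomainSAW.measurable_of_top _).aemeasurable) hrange
    (fun δ γ => SimpleGraph.Walk.toCurve_apply_zero _ _)
    (fun δ γ => SimpleGraph.Walk.toCurve_apply_one _ _) hab.tendsto_fst hab.tendsto_snd hNR

/-- **Floor-class reach of the line from the cocycle.**  `HexAvoidanceCocycleFloor → HexNonRetracingFloor →
HexConjectureFloor` (statements 3♭, 5♭ of the skeleton `Cruxes/HexConjecture/Lines/root_locality_replaces_loewner.lean`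
give statement 7♭'s hypothesis; 4♭ and 6 are landed and consumed inside `convergesInLawToSLE_at_of_cocycle_at`).
[cite: LawlerSchrammWerner2003Restriction, Thm. 6.1 (p. 23), transposed to the lattice] -/
theorem hexConjectureFloor_of_cocycle_nonRetracing
    (hCocycle : ∀ (D D' : DobrushinDomain) (ρ : ℝ) (a b : ℝ → HexVertex) (μ : Measure (CurveClass ℂ)),
      (0 < ρ ∧ (D.pt 1).im = (D.pt 0).im ∧ D.carrier ⊆ {z : ℂ | (D.pt 0).im < z.im} ∧
        D.carrier ∩ ball (D.pt 0) ρ = {z : ℂ | (D.pt 0).im < z.im} ∩ ball (D.pt 0) ρ ∧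
        D.carrier ∩ ball (D.pt 1) ρ = {z : ℂ | (D.pt 1).im < z.im} ∩ ball (D.pt 1) ρ) →
      IsEmbEndpointApprox hexGraph hexCenter D a b →
      (∀ᶠ δ : ℝ in 𝓝[>] 0,
        (a δ ∈ embMeshDomain hexGraph hexCenter D.carrier δ ∧
          ∃ w, hexGraph.Adj (a δ) w ∧ ¬ (hexDomainGraph D.carrier δ).Adj (a δ) w) ∧
        (b δ ∈ embMeshDomain hexGraph hexCenter D.carrier δ ∧
          ∃ w, hexGraph.Adj (b δ) w ∧ ¬ (hexDomainGraph D.carrier δ).Adj (b δ) w)) →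
      D.IsHullSubdomain D' → IsSLELaw ((8 : ℝ≥0) / 3) D μ →
      Tendsto (fun δ : ℝ =>
        ((hexSAWLaw D.carrier δ (a δ) (b δ)).map
            (fun γ : HexDomainSAW D.carrier δ (a δ) (b δ) => γ.curve))
          (CurveClass.rangeSubset (closure D'.carrier)))
        (𝓝[>] 0) (𝓝 (μ (CurveClass.rangeSubset (closure D'.carrier)))))
    (hNR : ∀ (D : DobrushinDomain) (ρ : ℝ) (a b : ℝ → HexVertex),
      (0 < ρ ∧ (D.pt 1).im = (D.pt 0).im ∧ D.carrier ⊆ {z : ℂ | (D.pt 0).im < z.im} ∧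
        D.carrier ∩ ball (D.pt 0) ρ = {z : ℂ | (D.pt 0).im < z.im} ∩ ball (D.pt 0) ρ ∧
        D.carrier ∩ ball (D.pt 1) ρ = {z : ℂ | (D.pt 1).im < z.im} ∩ ball (D.pt 1) ρ) →
      IsEmbEndpointApprox hexGraph hexCenter D a b →
      (∀ᶠ δ : ℝ in 𝓝[>] 0,
        (a δ ∈ embMeshDomain hexGraph hexCenter D.carrier δ ∧
          ∃ w, hexGraph.Adj (a δ) w ∧ ¬ (hexDomainGraph D.carrier δ).Adj (a δ) w) ∧
        (b δ ∈ embMeshDomain hexGraph hexCenter D.carrier δ ∧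
          ∃ w, hexGraph.Adj (b δ) w ∧ ¬ (hexDomainGraph D.carrier δ).Adj (b δ) w)) →
      ∀ ℓ : ℝ, 0 < ℓ → ∀ η : ℝ, 0 < η → ∃ ε : ℝ, 0 < ε ∧ ∀ᶠ δ : ℝ in 𝓝[>] 0,
        hexSAWLaw D.carrier δ (a δ) (b δ)
            {γ | ∃ c : Curve ℂ, CurveClass.mk c = γ.curve ∧ ∃ s t : Fin 3 → unitInterval,
              (∀ i, s i ≤ t i) ∧ t 0 < s 1 ∧ t 1 < s 2 ∧
              (∀ i, ℓ ≤ Metric.diam ((⇑c) '' Set.Icc (s i) (t i))) ∧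
              ∀ i j, Metric.hausdorffDist ((⇑c) '' Set.Icc (s i) (t i))
                ((⇑c) '' Set.Icc (s j) (t j)) ≤ ε} ≤ ENNReal.ofReal η) :
    ∀ (D : DobrushinDomain) (ρ : ℝ) (a b : ℝ → HexVertex),
      (0 < ρ ∧ (D.pt 1).im = (D.pt 0).im ∧ D.carrier ⊆ {z : ℂ | (D.pt 0).im < z.im} ∧
        D.carrier ∩ ball (D.pt 0) ρ = {z : ℂ | (D.pt 0).im < z.im} ∩ ball (D.pt 0) ρ ∧
        D.carrier ∩ ball (D.pt 1) ρ = {z : ℂ | (D.pt 1).im < z.im} ∩ ball (D.pt 1) ρ) →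
      IsEmbEndpointApprox hexGraph hexCenter D a b →
      (∀ᶠ δ : ℝ in 𝓝[>] 0,
        (a δ ∈ embMeshDomain hexGraph hexCenter D.carrier δ ∧
          ∃ w, hexGraph.Adj (a δ) w ∧ ¬ (hexDomainGraph D.carrier δ).Adj (a δ) w) ∧
        (b δ ∈ embMeshDomain hexGraph hexCenter D.carrier δ ∧
          ∃ w, hexGraph.Adj (b δ) w ∧ ¬ (hexDomainGraph D.carrier δ).Adj (b δ) w)) →
      ConvergesInLawToSLE ((8 : ℝ≥0) / 3) D
        (fun δ (γ : HexDomainSAW D.carrier δ (a δ) (b δ)) => γ.curve)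
        (fun δ => hexSAWLaw D.carrier δ (a δ) (b δ)) :=
  fun D ρ a b hfl hab hbd =>
    convergesInLawToSLE_at_of_cocycle_at hab (fun D' μ hD' hμ => hCocycle D D' ρ a b μ hfl hab hbd hD' hμ)
      (hNR D ρ a b hfl hab hbd)

/-- **The crux on the floor class from DCS Conjecture 2, half-plane arch tightness and non-retracing.**
`HexObservableLimitR` (= `SAWDevelopingMap.HexObservableLimit`, stmt-CriticalPhenomena-14003) `→ HalfPlaneArchTightness`
(crux-10472's registered open stub, verbatim) `→ HexNonRetracingFloor → HexConjectureFloor`: convergence in law of the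
critical hexagonal SAW to chordal SLE(8/3) on every FLOOR domain (Jordan, above the line through its marks, flat
`ρ`-half-discs at both) with discrete-boundary lattice endpoints — with NO tightness input (compare crux-10472's
`FloorRatio.stub_floorObservableToSLE_of_estimates`, which consumes `HexTight`).
[cite: LawlerSchrammWerner2004SAW, §3.4 ("SAW satisfies restriction") and Prop. 2; DCS 2012 Conj. 2 as hypothesis] -/
theorem hexConjectureFloor_of_archTightness
    (hO : Summit.CriticalPhenomena.SAWScalingLimit.Theses.SAWDefectDecoherence.HexObservableLimitR)
    (hT : ∀ ε : ℝ, 0 < ε → ∃ K : ℝ, 0 < K ∧ ∀ (n : ℕ), 1 ≤ n → ∀ (Λ B : Finset HexVertex)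
      (s t : Sym2 HexVertex), s ∈ hexDomainBoundary Λ → t ∈ hexDomainBoundary Λ → s ≠ t →
      dist (hexMidpoint s) (hexMidpoint t) ≤ n → (hexMidpoint t).im = (hexMidpoint s).im →
      (∀ v ∈ Λ, (hexMidpoint s).im < (hexCenter v).im) →
      (∀ v : HexVertex, v ∈ B ↔ ((hexMidpoint s).im < (hexCenter v).im ∧
        dist (hexCenter v) (hexMidpoint s) ≤ 2 * K * n)) →
      (∑ γ : HexMidEdgeSAW Λ s t, if ∃ v ∈ γ.verts, K * n ≤ dist (hexCenter v) (hexMidpoint s)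
        then hexCriticalFugacity ^ γ.length else 0) ≤
      ε * ∑ γ : HexMidEdgeSAW B s t, hexCriticalFugacity ^ γ.length)
    (hNR : ∀ (D : DobrushinDomain) (ρ : ℝ) (a b : ℝ → HexVertex),
      (0 < ρ ∧ (D.pt 1).im = (D.pt 0).im ∧ D.carrier ⊆ {z : ℂ | (D.pt 0).im < z.im} ∧
        D.carrier ∩ ball (D.pt 0) ρ = {z : ℂ | (D.pt 0).im < z.im} ∩ ball (D.pt 0) ρ ∧
        D.carrier ∩ ball (D.pt 1) ρ = {z : ℂ | (D.pt 1).im < z.im} ∩ ball (D.pt 1) ρ) →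
      IsEmbEndpointApprox hexGraph hexCenter D a b →
      (∀ᶠ δ : ℝ in 𝓝[>] 0,
        (a δ ∈ embMeshDomain hexGraph hexCenter D.carrier δ ∧
          ∃ w, hexGraph.Adj (a δ) w ∧ ¬ (hexDomainGraph D.carrier δ).Adj (a δ) w) ∧
        (b δ ∈ embMeshDomain hexGraph hexCenter D.carrier δ ∧
          ∃ w, hexGraph.Adj (b δ) w ∧ ¬ (hexDomainGraph D.carrier δ).Adj (b δ) w)) →
      ∀ ℓ : ℝ, 0 < ℓ → ∀ η : ℝ, 0 < η → ∃ ε : ℝ, 0 < ε ∧ ∀ᶠ δ : ℝ in 𝓝[>] 0,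
        hexSAWLaw D.carrier δ (a δ) (b δ)
            {γ | ∃ c : Curve ℂ, CurveClass.mk c = γ.curve ∧ ∃ s t : Fin 3 → unitInterval,
              (∀ i, s i ≤ t i) ∧ t 0 < s 1 ∧ t 1 < s 2 ∧
              (∀ i, ℓ ≤ Metric.diam ((⇑c) '' Set.Icc (s i) (t i))) ∧
              ∀ i j, Metric.hausdorffDist ((⇑c) '' Set.Icc (s i) (t i))
                ((⇑c) '' Set.Icc (s j) (t j)) ≤ ε} ≤ ENNReal.ofReal η) :
    ∀ (D : DobrushinDomain) (ρ : ℝ) (a b : ℝ → HexVertex),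
      (0 < ρ ∧ (D.pt 1).im = (D.pt 0).im ∧ D.carrier ⊆ {z : ℂ | (D.pt 0).im < z.im} ∧
        D.carrier ∩ ball (D.pt 0) ρ = {z : ℂ | (D.pt 0).im < z.im} ∩ ball (D.pt 0) ρ ∧
        D.carrier ∩ ball (D.pt 1) ρ = {z : ℂ | (D.pt 1).im < z.im} ∩ ball (D.pt 1) ρ) →
      IsEmbEndpointApprox hexGraph hexCenter D a b →
      (∀ᶠ δ : ℝ in 𝓝[>] 0,
        (a δ ∈ embMeshDomain hexGraph hexCenter D.carrier δ ∧
          ∃ w, hexGraph.Adj (a δ) w ∧ ¬ (hexDomainGraph D.carrier δ).Adj (a δ) w) ∧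
        (b δ ∈ embMeshDomain hexGraph hexCenter D.carrier δ ∧
          ∃ w, hexGraph.Adj (b δ) w ∧ ¬ (hexDomainGraph D.carrier δ).Adj (b δ) w)) →
      ConvergesInLawToSLE ((8 : ℝ≥0) / 3) D
        (fun δ (γ : HexDomainSAW D.carrier δ (a δ) (b δ)) => γ.curve)
        (fun δ => hexSAWLaw D.carrier δ (a δ) (b δ)) :=
  hexConjectureFloor_of_cocycle_nonRetracing (hexAvoidanceCocycleFloor_of_archTightness hO hT) hNR

end Summit.CriticalPhenomena.SAWScalingLimit.Theorems.HexConjecture.RootLocality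

end
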